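import Literature.NumberTheory.Automorphic.HeckeFamilyTraceMultiplicity
import HarnessLib

/-!
# Virtual trace identities determine virtual multiplicities
# (the linear algebra of Eichler's basis theorem with several levels: Eichler 1973, Ch. IV §1;
# Pizer 1980, proof of Thm. 2.28)

Topic `NumberTheory/Automorphic`; pure linear algebra, theorems only (no definition, no named
fact; D-0026). A complement to the abstract engine `HeckeFamilyTraceMultiplicity.lean` (equal
traces of two semisimple commuting Hecke families ⇒ equal multiplicities). Eichler's basis theorem
for a definite quaternion algebra of discriminant `N⁻` with several prime factors (and Pizer's
Thm. 2.28 already for one prime) compares the traces of the Brandt matrices not with the traces of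
`T_n` on one space of cusp forms but with an ALTERNATING combination of such traces,
`tr B(n) = Σ_{d ∣ N⁻} μ(N⁻/d) σ₀(N⁻/d) tr (T_n | S_k(Γ₀(d N⁺)))`, `(n, N) = 1` (Eichler 1973,
Ch. IV §1: induction on the number of primes, one sign change per prime). The semisimplicity
argument ("two representations of a semisimple ring are equivalent iff their traces are equal",
Pizer 1980, p. 359) goes through verbatim for such virtual identities, and this file records it in
that form:

* `IsHeckeFamily.pi` — a finite family of Hecke families `T i` (same `N`, same constants `c`) on
  spaces `V i` gives the componentwise Hecke family on `Π i, V i`; `listProd_pi` — its products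
  `∏ (T q - a)` are componentwise.
* `sum_mul_trace_listProd_eq_zero` — if `Σ_i a_i tr T_i(n) = 0` for all `n ≥ 1` prime to `N`, then
  `Σ_i a_i tr ∏_j (T_i q_j - b_j) = 0` for all primes `q_j ∤ N` (span identity on `Π V_i`, read
  block by block).
* `sum_mul_finrank_eigenChar_eq_zero_of_sum_mul_trace_eq_zero` — **virtual trace identity ⇒
  virtual multiplicity identity**: for semisimple commuting Hecke families `T_i` on
  finite-dimensional `V_i` and scalars `a_i` with `Σ_i a_i tr T_i(n) = 0` for all `n ≥ 1` prime to
  `N`, every eigenvalue system `χ` has `Σ_i a_i dim (V_i)_χ = 0`;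
  `sum_intCast_mul_finrank_eigenChar_eq_zero` is the integer-coefficient form.
* `sum_mul_finrank_iInf_maxGenEigenspace_eq_zero` (and `sum_intCast_…`) — the same for merely
  COMMUTING families, with multiplicities read on the simultaneous generalised eigenspaces
  `⋂_q ⋃_k ker (T q - χ q)^k` (`trace_listProd_eq_sum_finrank_iInf_maxGenEigenspace_mul`: on such a
  space `∏ (T qⱼ - bⱼ)` is its scalar plus a nilpotent, `isNilpotent_listProd_sub_smul_one`); this is
  the form needed for the weight-`k` Brandt matrices, whose commutativity is elementary while their
  diagonalisability is not; `eigenChar_le_iInf_maxGenEigenspace`,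
  `iInf_maxGenEigenspace_eq_eigenChar` compare with the semisimple case.

## References

* [Eichler1973] M. Eichler, LNM 320 (1973), Ch. IV §1 (Theorem, and the induction on the primes of
  the level).
* [Pizer1980] A. Pizer, J. Algebra 64 (1980), proof of Thm. 2.28 (p. 359–360).
-/

noncomputable section

open Module Module.End

namespace Literature.NumberTheory.Automorphic

universe u v

variable {ι : Type u} {V : ι → Type v} [∀ i, AddCommGroup (V i)] [∀ i, Module ℂ (V i)]
  {N : ℕ} {c : ℕ → ℂ}

/-! ### Componentwise families on `Π i, V i` -/

section Pi

/-- The `i`-th diagonal block of the componentwise endomorphism `(v_j)_j ↦ (f_j v_j)_j` is `f_i`.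
[folklore] -/
theorem proj_comp_pi_comp_single [DecidableEq ι] (f : ∀ i, Module.End ℂ (V i)) (i : ι) :
    (LinearMap.proj i).comp ((LinearMap.pi fun j => (f j).comp (LinearMap.proj j)).comp
      (LinearMap.single ℂ V i)) = f i := by
  ext v
  simp

/-- The componentwise endomorphism of the identities is the identity. [folklore] -/
theorem pi_one_comp_proj :
    (LinearMap.pi fun j => (1 : Module.End ℂ (V j)).comp (LinearMap.proj j)) =
      (1 : Module.End ℂ (∀ i, V i)) := by
  ext x j
  simp

/-- Componentwise endomorphisms compose componentwise. [folklore] -/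
theorem pi_comp_proj_mul (f g : ∀ i, Module.End ℂ (V i)) :
    (LinearMap.pi fun j => (f j).comp (LinearMap.proj j)) *
        (LinearMap.pi fun j => (g j).comp (LinearMap.proj j)) =
      LinearMap.pi fun j => (f j * g j).comp (LinearMap.proj j) := by
  ext x j
  simp

/-- Componentwise endomorphisms subtract componentwise. [folklore] -/
theorem pi_comp_proj_sub (f g : ∀ i, Module.End ℂ (V i)) :
    (LinearMap.pi fun j => (f j).comp (LinearMap.proj j)) -
        (LinearMap.pi fun j => (g j).comp (LinearMap.proj j)) =
      LinearMap.pi fun j => (f j - g j).comp (LinearMap.proj j) := by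
  ext x j
  simp

/-- Componentwise endomorphisms scale componentwise. [folklore] -/
theorem pi_comp_proj_smul (a : ℂ) (f : ∀ i, Module.End ℂ (V i)) :
    a • (LinearMap.pi fun j => (f j).comp (LinearMap.proj j)) =
      LinearMap.pi fun j => (a • f j).comp (LinearMap.proj j) := by
  ext x j
  simp

variable {T : ∀ i, ℕ → Module.End ℂ (V i)}

/-- **A finite family of Hecke families (same `N`, `c`) gives the componentwise Hecke family on
`Π i, V i`.** [folklore] -/
theorem IsHeckeFamily.pi (hT : ∀ i, IsHeckeFamily N c (T i)) :
    IsHeckeFamily N c fun n => LinearMap.pi fun j => (T j n).comp (LinearMap.proj j) where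
  map_one := by
    have : (fun j => (T j 1).comp (LinearMap.proj (R := ℂ) (φ := V) j)) =
        fun j => (1 : Module.End ℂ (V j)).comp (LinearMap.proj j) := by
      funext j; rw [(hT j).map_one]
    rw [this, pi_one_comp_proj]
  map_mul_of_coprime hmn hN := by
    rw [pi_comp_proj_mul]
    congr 1
    funext j
    rw [(hT j).map_mul_of_coprime hmn hN]
  map_prime_pow hq hqN a := by
    rw [pi_comp_proj_mul, pi_comp_proj_smul, pi_comp_proj_sub]
    congr 1
    funext j
    rw [(hT j).map_prime_pow hq hqN a]

/-- The products `∏ (T q - a)` of the componentwise family are componentwise. [folklore] -/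
theorem listProd_pi (L : List (ℕ × ℂ)) :
    IsHeckeFamily.listProd (fun n => LinearMap.pi fun j => (T j n).comp (LinearMap.proj j)) L =
      LinearMap.pi fun j => (IsHeckeFamily.listProd (T j) L).comp (LinearMap.proj j) := by
  induction L with
  | nil => simp only [IsHeckeFamily.listProd_nil, pi_one_comp_proj]
  | cons qa L ih =>
    rw [IsHeckeFamily.listProd_cons, ih, ← pi_one_comp_proj, pi_comp_proj_smul, pi_comp_proj_sub,
      pi_comp_proj_mul]
    simp only [IsHeckeFamily.listProd_cons]

/-- **A virtual trace identity for the `T_i(n)` passes to every product `∏_j (T_i q_j - b_j)`**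
(`q_j ∤ N` primes): if `Σ_i a_i tr T_i(n) = 0` for all `n ≥ 1` prime to `N`, then
`Σ_i a_i tr ∏_j (T_i q_j - b_j) = 0` — the products lie in the span of the componentwise family
(`IsHeckeFamily.listProd_mem_span`), on which the linear functional `x ↦ Σ_i a_i tr (block_i x)`
vanishes. [cite: Pizer1980, Thm. 2.28 (proof)] -/
theorem sum_mul_trace_listProd_eq_zero [Fintype ι] (hT : ∀ i, IsHeckeFamily N c (T i)) (a : ι → ℂ)
    (htr : ∀ n : ℕ, 0 < n → n.Coprime N → ∑ i, a i * LinearMap.trace ℂ (V i) (T i n) = 0)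
    {L : List (ℕ × ℂ)} (hL : ∀ qa ∈ L, qa.1.Prime ∧ ¬ qa.1 ∣ N) :
    ∑ i, a i * LinearMap.trace ℂ (V i) (IsHeckeFamily.listProd (T i) L) = 0 := by
  classical
  have key : ∀ x ∈ (IsHeckeFamily.pi hT).span,
      ∑ i, a i * LinearMap.trace ℂ (V i)
        ((LinearMap.proj i).comp (x.comp (LinearMap.single ℂ V i))) = 0 := by
    intro x hx
    induction hx using Submodule.span_induction with
    | mem x hx =>
      obtain ⟨n, ⟨hn, hnN⟩, rfl⟩ := hx
      simp only [proj_comp_pi_comp_single]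
      exact htr n hn hnN
    | zero => simp
    | add x y _ _ hx hy =>
      simp only [LinearMap.add_comp, LinearMap.comp_add, map_add, mul_add, Finset.sum_add_distrib,
        hx, hy, add_zero]
    | smul b x _ hx =>
      simp only [LinearMap.smul_comp, LinearMap.comp_smul, map_smul, smul_eq_mul, mul_left_comm _ b,
        ← Finset.mul_sum, hx, mul_zero]
  have hmem := (IsHeckeFamily.pi hT).listProd_mem_span hL
  rw [listProd_pi] at hmem
  have h := key _ hmem
  simp only [proj_comp_pi_comp_single] at h
  exact h

end Pi

/-! ### Virtual trace identity ⇒ virtual multiplicity identity -/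

section Multiplicity

variable [Fintype ι] [∀ i, FiniteDimensional ℂ (V i)] {T : ∀ i, ℕ → Module.End ℂ (V i)}

/-- **Virtual trace identities determine virtual multiplicities** (Eichler 1973, Ch. IV §1;
Pizer 1980, proof of Thm. 2.28: "two representations of a semisimple ring are equivalent if and
only if their traces are equal"). For semisimple commuting Hecke families `T_i` away from `N`
(same prime-power constants `c`) on finite-dimensional spaces `V_i` and scalars `a_i` with
`Σ_i a_i tr T_i(n) = 0` for all `n ≥ 1` prime to `N`, every eigenvalue system `χ` satisfies
`Σ_i a_i dim (V_i)_χ = 0`: kill all the other systems occurring in some `V_i` by a product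
`∏ (T q_ψ - ψ(q_ψ))`, `ψ(q_ψ) ≠ χ(q_ψ)`, whose trace on `V_i` is `dim (V_i)_χ` times a common non-zero
scalar. [cite: Eichler1973, Ch. IV §1] [cite: Pizer1980, Thm. 2.28 (proof)] -/
theorem sum_mul_finrank_eigenChar_eq_zero_of_sum_mul_trace_eq_zero
    (hT : ∀ i, IsHeckeFamily N c (T i)) (hs : ∀ i, IsSemisimpleFamily N (T i)) (a : ι → ℂ)
    (htr : ∀ n : ℕ, 0 < n → n.Coprime N → ∑ i, a i * LinearMap.trace ℂ (V i) (T i n) = 0)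
    (χ : PrimesNotDvd N → ℂ) :
    ∑ i, a i * (Module.finrank ℂ (eigenChar N (T i) χ) : ℂ) = 0 := by
  classical
  -- the other characters occurring in some `V i`
  obtain ⟨X, hXne, hX⟩ : ∃ X : Finset (PrimesNotDvd N → ℂ), (∀ ψ ∈ X, ψ ≠ χ) ∧
      ∀ i φ, eigenChar N (T i) φ ≠ ⊥ → φ ≠ χ → φ ∈ X := by
    refine ⟨(Finset.univ.biUnion fun i => (hs i).finite_ne_bot.toFinset).erase χ,
      fun ψ hψ => (Finset.mem_erase.mp hψ).1, fun i φ hφ hne => ?_⟩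
    exact Finset.mem_erase.mpr ⟨hne, Finset.mem_biUnion.mpr
      ⟨i, Finset.mem_univ i, (hs i).finite_ne_bot.mem_toFinset.mpr hφ⟩⟩
  -- separating primes
  have hsep : ∀ ψ : X, ∃ q : PrimesNotDvd N, (ψ : PrimesNotDvd N → ℂ) q ≠ χ q := fun ψ =>
    Function.ne_iff.mp (hXne ψ ψ.2)
  choose qsep hqsep using hsep
  -- the killing product and its scalar on `V_φ`
  let L : List (ℕ × ℂ) :=
    X.attach.toList.map fun ψ => ((qsep ψ : ℕ), (ψ : PrimesNotDvd N → ℂ) (qsep ψ))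
  have hLprime : ∀ qa ∈ L, qa.1.Prime ∧ ¬ qa.1 ∣ N := by
    intro qa hqa
    obtain ⟨ψ, -, rfl⟩ := List.mem_map.mp hqa
    exact (qsep ψ).2
  let s : (PrimesNotDvd N → ℂ) → ℂ :=
    fun φ => ∏ ψ ∈ X.attach, (φ (qsep ψ) - (ψ : PrimesNotDvd N → ℂ) (qsep ψ))
  have hscalar : ∀ φ : PrimesNotDvd N → ℂ,
      (L.map fun qa => charExt φ qa.1 - qa.2).prod = s φ := by
    intro φ
    change ((X.attach.toList.map _).map _).prod = ∏ ψ ∈ X.attach, _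
    rw [List.map_map, Finset.prod_map_toList]
    simp only [Function.comp_apply, charExt_apply]
  have hsX : ∀ φ ∈ X, s φ = 0 := fun φ hφ =>
    Finset.prod_eq_zero (Finset.mem_attach X ⟨φ, hφ⟩) (sub_self _)
  have hsχ : s χ ≠ 0 := Finset.prod_ne_zero_iff.mpr fun ψ _ =>
    sub_ne_zero.mpr (hqsep ψ).symm
  -- the virtual trace of the product
  have h := sum_mul_trace_listProd_eq_zero hT a htr hLprime
  have hi : ∀ i, LinearMap.trace ℂ (V i) (IsHeckeFamily.listProd (T i) L) =
      (Module.finrank ℂ (eigenChar N (T i) χ) : ℂ) * s χ := fun i =>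
    (hs i).trace_listProd_eq_finrank_mul χ hLprime s hscalar fun φ hφ hne => hsX φ (hX i φ hφ hne)
  simp only [hi, ← mul_assoc, ← Finset.sum_mul] at h
  exact (mul_eq_zero.mp h).resolve_right hsχ

/-- **Virtual trace identity ⇒ virtual multiplicity identity, integer coefficients**:
`Σ_i a_i tr T_i(n) = 0` for all `n ≥ 1` prime to `N` (`a_i ∈ ℤ`) gives
`Σ_i a_i dim (V_i)_χ = 0` in `ℤ` for every system `χ`. [cite: Eichler1973, Ch. IV §1] -/
theorem sum_intCast_mul_finrank_eigenChar_eq_zero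
    (hT : ∀ i, IsHeckeFamily N c (T i)) (hs : ∀ i, IsSemisimpleFamily N (T i)) (a : ι → ℤ)
    (htr : ∀ n : ℕ, 0 < n → n.Coprime N → ∑ i, (a i : ℂ) * LinearMap.trace ℂ (V i) (T i n) = 0)
    (χ : PrimesNotDvd N → ℂ) :
    ∑ i, a i * (Module.finrank ℂ (eigenChar N (T i) χ) : ℤ) = 0 := by
  have h := sum_mul_finrank_eigenChar_eq_zero_of_sum_mul_trace_eq_zero hT hs (fun i => (a i : ℂ))
    htr χ
  exact_mod_cast h

end Multiplicity

/-! ### Commuting (not necessarily semisimple) families: generalised multiplicities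

For the weight-`k` Brandt matrices only the commutativity of the `T q` (`q ∤ N` prime) is
elementary (it follows from `T(mn) = T(m) T(n)`), while their diagonalisability needs an invariant
Hermitian form on `Sym^{k-2}`.  The trace argument does not need diagonalisability if
multiplicities are read on the SIMULTANEOUS GENERALISED eigenspaces
`V^χ = ⋂_q ⋃_k ker (T q - χ q)^k`: a product `∏ (T qⱼ - bⱼ)` acts on `V^χ` as the scalar
`∏ (χ(qⱼ) - bⱼ)` plus a nilpotent, so its trace there is still `dim V^χ · ∏ (χ(qⱼ) - bⱼ)`. -/

section GenEigen

variable {W : Type*} [AddCommGroup W] [Module ℂ W] {N : ℕ} {T : ℕ → Module.End ℂ W}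

/-- `T q` commutes with every product `∏ (T qⱼ - bⱼ)` over primes `qⱼ ∤ N` when the `T q`,
`q ∤ N` prime, pairwise commute. [folklore] -/
theorem commute_listProd (hc : ∀ q q' : PrimesNotDvd N, Commute (T q) (T q')) (q : PrimesNotDvd N)
    {L : List (ℕ × ℂ)} (hL : ∀ qa ∈ L, qa.1.Prime ∧ ¬ qa.1 ∣ N) :
    Commute (T q) (IsHeckeFamily.listProd T L) := by
  induction L with
  | nil => rw [IsHeckeFamily.listProd_nil]; exact Commute.one_right _
  | cons qa L ih =>
    rw [IsHeckeFamily.listProd_cons]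
    have hqa := hL qa (by simp)
    refine Commute.mul_right (Commute.sub_right (hc q ⟨qa.1, hqa⟩) ?_) (ih fun x hx => hL x (by simp [hx]))
    exact (Commute.one_right _).smul_right _

/-- **`∏ (T qⱼ - bⱼ)` is `∏ (χ(qⱼ) - bⱼ)` plus a nilpotent** when every `T q - χ(q)` (`q ∤ N`
prime) is nilpotent and the `T q` commute: `(x - c) y + c (y - s)` with `x - c`, `y - s`
nilpotent and everything commuting. [folklore] -/
theorem isNilpotent_listProd_sub_smul_one (hc : ∀ q q' : PrimesNotDvd N, Commute (T q) (T q'))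
    (χ : PrimesNotDvd N → ℂ) (hnil : ∀ q : PrimesNotDvd N, IsNilpotent (T q - χ q • 1))
    {L : List (ℕ × ℂ)} (hL : ∀ qa ∈ L, qa.1.Prime ∧ ¬ qa.1 ∣ N) :
    IsNilpotent (IsHeckeFamily.listProd T L - (L.map fun qa => charExt χ qa.1 - qa.2).prod • 1) := by
  induction L with
  | nil => simp
  | cons qa L ih =>
    have hqa := hL qa (by simp)
    have hL' : ∀ x ∈ L, x.1.Prime ∧ ¬ x.1 ∣ N := fun x hx => hL x (by simp [hx])
    set q : PrimesNotDvd N := ⟨qa.1, hqa⟩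
    set x : Module.End ℂ W := T qa.1 - qa.2 • 1
    set y : Module.End ℂ W := IsHeckeFamily.listProd T L
    set c : ℂ := charExt χ qa.1 - qa.2
    set s : ℂ := (L.map fun qa => charExt χ qa.1 - qa.2).prod
    have hxc : x - c • 1 = T q - χ q • 1 := by
      simp only [x, c, q, charExt_apply χ ⟨qa.1, hqa⟩, sub_smul]
      abel
    have hn₁ : IsNilpotent (x - c • 1) := hxc ▸ hnil q
    have hn₂ : IsNilpotent (y - s • 1) := ih hL'
    -- commutations
    have hTy : Commute (T q) y := commute_listProd hc q hL'
    have hxy : Commute (x - c • 1) y := by rw [hxc]; exact Commute.sub_left hTy ((Commute.one_left _).smul_left _)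
    have h12 : Commute ((x - c • 1) * y) (c • (y - s • 1)) := by
      refine Commute.smul_right (Commute.sub_right ?_ ((Commute.one_right _).smul_right _)) _
      exact Commute.mul_left hxy (Commute.refl y)
    have key : ∀ (x' y' : Module.End ℂ W) (c' s' : ℂ),
        x' * y' - (c' * s') • (1 : Module.End ℂ W) = (x' - c' • 1) * y' + c' • (y' - s' • 1) := by
      intro x' y' c' s'
      rw [sub_mul, smul_sub, smul_smul, smul_mul_assoc, one_mul]
      abel
    rw [IsHeckeFamily.listProd_cons, List.map_cons, List.prod_cons, key x y c s]
    exact h12.isNilpotent_add (hxy.isNilpotent_mul_right hn₁) (hn₂.smul c)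

/-- **Trace of `∏ (T qⱼ - bⱼ)` on a space where each `T q - χ(q)` is nilpotent**:
`dim W · ∏ (χ(qⱼ) - bⱼ)` (a scalar plus a nilpotent; nilpotents have trace `0`). [folklore] -/
theorem trace_listProd_of_isNilpotent [FiniteDimensional ℂ W]
    (hc : ∀ q q' : PrimesNotDvd N, Commute (T q) (T q')) (χ : PrimesNotDvd N → ℂ)
    (hnil : ∀ q : PrimesNotDvd N, IsNilpotent (T q - χ q • 1))
    {L : List (ℕ × ℂ)} (hL : ∀ qa ∈ L, qa.1.Prime ∧ ¬ qa.1 ∣ N) :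
    LinearMap.trace ℂ W (IsHeckeFamily.listProd T L) =
      (Module.finrank ℂ W : ℂ) * (L.map fun qa => charExt χ qa.1 - qa.2).prod := by
  have hn := isNilpotent_listProd_sub_smul_one hc χ hnil hL
  have h0 : LinearMap.trace ℂ W
      (IsHeckeFamily.listProd T L - (L.map fun qa => charExt χ qa.1 - qa.2).prod • 1) = 0 :=
    (LinearMap.isNilpotent_trace_of_isNilpotent hn).eq_zero
  rw [map_sub, map_smul, LinearMap.trace_one, sub_eq_zero] at h0
  rw [h0, smul_eq_mul, mul_comm]

/-- The simultaneous generalised eigenspaces of a commuting family are independent. [folklore] -/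
theorem iSupIndep_iInf_maxGenEigenspace (hc : ∀ q q' : PrimesNotDvd N, Commute (T q) (T q')) :
    iSupIndep fun χ : PrimesNotDvd N → ℂ => ⨅ q : PrimesNotDvd N, (T q).maxGenEigenspace (χ q) :=
  Module.End.independent_iInf_maxGenEigenspace_of_forall_mapsTo (fun q : PrimesNotDvd N => T q)
    fun q q' φ => Module.End.mapsTo_maxGenEigenspace_of_comm (hc q' q) φ

/-- The simultaneous generalised eigenspaces of a commuting family span (over `ℂ`, finite
dimension). [folklore] -/
theorem iSup_iInf_maxGenEigenspace_eq_top [FiniteDimensional ℂ W]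
    (hc : ∀ q q' : PrimesNotDvd N, Commute (T q) (T q')) :
    ⨆ χ : PrimesNotDvd N → ℂ, ⨅ q : PrimesNotDvd N, (T q).maxGenEigenspace (χ q) = ⊤ :=
  Module.End.iSup_iInf_maxGenEigenspace_eq_top_of_iSup_maxGenEigenspace_eq_top_of_commute
    (fun q : PrimesNotDvd N => T q) (fun q q' _ => hc q q')
    (fun _ => Module.End.iSup_maxGenEigenspace_eq_top _)

/-- Only finitely many systems have a non-zero simultaneous generalised eigenspace. [folklore] -/
theorem finite_iInf_maxGenEigenspace_ne_bot [FiniteDimensional ℂ W]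
    (hc : ∀ q q' : PrimesNotDvd N, Commute (T q) (T q')) :
    {χ : PrimesNotDvd N → ℂ | (⨅ q : PrimesNotDvd N, (T q).maxGenEigenspace (χ q)) ≠ ⊥}.Finite :=
  WellFoundedGT.finite_ne_bot_of_iSupIndep (iSupIndep_iInf_maxGenEigenspace hc)

/-- The `T q` (`q ∤ N` prime) preserve each simultaneous generalised eigenspace. [folklore] -/
theorem mapsTo_iInf_maxGenEigenspace (hc : ∀ q q' : PrimesNotDvd N, Commute (T q) (T q'))
    (q : PrimesNotDvd N) (χ : PrimesNotDvd N → ℂ) :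
    Set.MapsTo (T q) (⨅ q' : PrimesNotDvd N, (T q').maxGenEigenspace (χ q') : Submodule ℂ W)
      (⨅ q' : PrimesNotDvd N, (T q').maxGenEigenspace (χ q') : Submodule ℂ W) := by
  intro v hv
  rw [SetLike.mem_coe, Submodule.mem_iInf] at hv ⊢
  exact fun q' => Module.End.mapsTo_maxGenEigenspace_of_comm (hc q' q) (χ q') (hv q')

/-- The products `∏ (T qⱼ - bⱼ)` preserve each simultaneous generalised eigenspace. [folklore] -/
theorem listProd_mapsTo_iInf_maxGenEigenspace (hc : ∀ q q' : PrimesNotDvd N, Commute (T q) (T q'))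
    {L : List (ℕ × ℂ)} (hL : ∀ qa ∈ L, qa.1.Prime ∧ ¬ qa.1 ∣ N) (χ : PrimesNotDvd N → ℂ) :
    Set.MapsTo (IsHeckeFamily.listProd T L)
      (⨅ q' : PrimesNotDvd N, (T q').maxGenEigenspace (χ q') : Submodule ℂ W)
      (⨅ q' : PrimesNotDvd N, (T q').maxGenEigenspace (χ q') : Submodule ℂ W) := by
  induction L with
  | nil => intro v hv; simpa using hv
  | cons qa L ih =>
    have hqa := hL qa (by simp)
    have ih' := ih fun x hx => hL x (by simp [hx])
    intro v hv
    rw [IsHeckeFamily.listProd_cons, Module.End.mul_apply, LinearMap.sub_apply, LinearMap.smul_apply,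
      Module.End.one_apply]
    exact Submodule.sub_mem _ (mapsTo_iInf_maxGenEigenspace hc ⟨qa.1, hqa⟩ χ (ih' hv))
      (Submodule.smul_mem _ _ (ih' hv))

/-- **Trace of `∏ (T qⱼ - bⱼ)` restricted to a simultaneous generalised eigenspace**:
`dim V^χ · ∏ (χ(qⱼ) - bⱼ)`. [folklore] -/
theorem trace_restrict_listProd_iInf_maxGenEigenspace [FiniteDimensional ℂ W]
    (hc : ∀ q q' : PrimesNotDvd N, Commute (T q) (T q')) {L : List (ℕ × ℂ)}
    (hL : ∀ qa ∈ L, qa.1.Prime ∧ ¬ qa.1 ∣ N) (χ : PrimesNotDvd N → ℂ) :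
    LinearMap.trace ℂ _ ((IsHeckeFamily.listProd T L).restrict
        (listProd_mapsTo_iInf_maxGenEigenspace hc hL χ)) =
      (Module.finrank ℂ (⨅ q' : PrimesNotDvd N, (T q').maxGenEigenspace (χ q') : Submodule ℂ W) : ℂ) *
        (L.map fun qa => charExt χ qa.1 - qa.2).prod := by
  classical
  set G : Submodule ℂ W := ⨅ q' : PrimesNotDvd N, (T q').maxGenEigenspace (χ q') with hG
  -- the family restricted to `G` (junk `0` where `T n` does not preserve `G`)
  let R : ℕ → Module.End ℂ G := fun n =>
    if h : Set.MapsTo (T n) G G then (T n).restrict h else 0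
  have hRq : ∀ q : PrimesNotDvd N, R q = (T q).restrict (mapsTo_iInf_maxGenEigenspace hc q χ) :=
    fun q => dif_pos (mapsTo_iInf_maxGenEigenspace hc q χ)
  have hRc : ∀ q q' : PrimesNotDvd N, Commute (R q) (R q') := fun q q' => by
    rw [hRq, hRq]
    exact LinearMap.restrict_commute (hc q q') _ _
  have hRnil : ∀ q : PrimesNotDvd N, IsNilpotent (R q - χ q • 1) := by
    intro q
    have hle : G ≤ (T q).maxGenEigenspace (χ q) := iInf_le _ q
    have hmaps : Set.MapsTo (T q - algebraMap ℂ (Module.End ℂ W) (χ q)) G G := fun v hv =>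
      Submodule.sub_mem _ (mapsTo_iInf_maxGenEigenspace hc q χ hv) (Submodule.smul_mem _ _ hv)
    have h := Module.End.isNilpotent_restrict_of_le (hp := hmaps) hle
      (Module.End.isNilpotent_restrict_maxGenEigenspace_sub_algebraMap (T q) (χ q))
    have heq : (T q - algebraMap ℂ (Module.End ℂ W) (χ q)).restrict hmaps = R q - χ q • 1 := by
      rw [hRq]
      ext ⟨v, hv⟩
      simp [LinearMap.restrict_apply, Algebra.algebraMap_eq_smul_one]
    rwa [heq] at h
  -- `listProd T L` restricted to `G` is `listProd R L`
  have hres : ∀ (L : List (ℕ × ℂ)) (hL : ∀ qa ∈ L, qa.1.Prime ∧ ¬ qa.1 ∣ N) (v : G),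
      ((IsHeckeFamily.listProd R L v : G) : W) = IsHeckeFamily.listProd T L v := by
    intro L hL
    induction L with
    | nil => intro v; simp
    | cons qa L ih =>
      have hqa := hL qa (by simp)
      have ih' := ih fun x hx => hL x (by simp [hx])
      intro v
      rw [IsHeckeFamily.listProd_cons, IsHeckeFamily.listProd_cons, Module.End.mul_apply,
        Module.End.mul_apply, LinearMap.sub_apply, LinearMap.sub_apply, LinearMap.smul_apply,
        LinearMap.smul_apply, Module.End.one_apply, Module.End.one_apply, Submodule.coe_sub,
        Submodule.coe_smul, show R qa.1 = R (⟨qa.1, hqa⟩ : PrimesNotDvd N) from rfl, hRq,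
        LinearMap.coe_restrict_apply, ih' v]
  have heq : (IsHeckeFamily.listProd T L).restrict (listProd_mapsTo_iInf_maxGenEigenspace hc hL χ) =
      IsHeckeFamily.listProd R L := by
    ext v
    rw [LinearMap.coe_restrict_apply, hres L hL v]
  rw [heq, trace_listProd_of_isNilpotent hRc χ hRnil hL]

/-- **Trace on the simultaneous generalised eigenspace decomposition**:
`tr ∏ (T qⱼ - bⱼ) = Σ_χ dim V^χ · ∏ (χ(qⱼ) - bⱼ)` (sum over the finitely many systems that
occur). [cite: Pizer1980, Remark 2.27] -/
theorem trace_listProd_eq_sum_finrank_iInf_maxGenEigenspace_mul [FiniteDimensional ℂ W]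
    (hc : ∀ q q' : PrimesNotDvd N, Commute (T q) (T q')) {L : List (ℕ × ℂ)}
    (hL : ∀ qa ∈ L, qa.1.Prime ∧ ¬ qa.1 ∣ N) :
    LinearMap.trace ℂ W (IsHeckeFamily.listProd T L) =
      ∑ χ ∈ (finite_iInf_maxGenEigenspace_ne_bot hc).toFinset,
        (Module.finrank ℂ (⨅ q' : PrimesNotDvd N, (T q').maxGenEigenspace (χ q') : Submodule ℂ W) : ℂ) *
          (L.map fun qa => charExt χ qa.1 - qa.2).prod := by
  classical
  have hint : DirectSum.IsInternal fun χ : PrimesNotDvd N → ℂ =>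
      (⨅ q' : PrimesNotDvd N, (T q').maxGenEigenspace (χ q') : Submodule ℂ W) :=
    DirectSum.isInternal_submodule_of_iSupIndep_of_iSup_eq_top (iSupIndep_iInf_maxGenEigenspace hc)
      (iSup_iInf_maxGenEigenspace_eq_top hc)
  rw [LinearMap.trace_eq_sum_trace_restrict' hint (finite_iInf_maxGenEigenspace_ne_bot hc)
    (fun χ => listProd_mapsTo_iInf_maxGenEigenspace hc hL χ)]
  exact Finset.sum_congr rfl fun χ _ => trace_restrict_listProd_iInf_maxGenEigenspace hc hL χ

/-- A simultaneous eigenspace lies in the simultaneous generalised eigenspace. [folklore] -/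
theorem eigenChar_le_iInf_maxGenEigenspace (χ : PrimesNotDvd N → ℂ) :
    eigenChar N T χ ≤ ⨅ q : PrimesNotDvd N, (T q).maxGenEigenspace (χ q) :=
  le_iInf fun q => (iInf_le _ q).trans Module.End.eigenspace_le_maxGenEigenspace

/-- For a family of diagonalisable operators the simultaneous generalised eigenspaces are the
simultaneous eigenspaces. [folklore] -/
theorem iInf_maxGenEigenspace_eq_eigenChar
    (hdiag : ∀ (q : PrimesNotDvd N) (μ : ℂ), (T q).maxGenEigenspace μ = (T q).eigenspace μ)
    (χ : PrimesNotDvd N → ℂ) :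
    (⨅ q : PrimesNotDvd N, (T q).maxGenEigenspace (χ q)) = eigenChar N T χ := by
  simp only [hdiag]
  rfl

end GenEigen

/-! ### Virtual trace identity ⇒ virtual generalised-multiplicity identity -/

section GenMultiplicity

variable [Fintype ι] [∀ i, FiniteDimensional ℂ (V i)] {T : ∀ i, ℕ → Module.End ℂ (V i)}

/-- **Virtual trace identities determine virtual generalised multiplicities**, for COMMUTING
(not necessarily semisimple) Hecke families: if `Σ_i a_i tr T_i(n) = 0` for all `n ≥ 1` prime
to `N`, then `Σ_i a_i dim (V_i)^χ = 0` for every system `χ`, where `(V_i)^χ` is the simultaneous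
generalised eigenspace. (Same killing-product argument; on `(V_i)^φ` the product acts as its scalar
plus a nilpotent, `trace_listProd_eq_sum_finrank_iInf_maxGenEigenspace_mul`.)
[cite: Eichler1973, Ch. IV §1] [cite: Pizer1980, Thm. 2.28 (proof)] -/
theorem sum_mul_finrank_iInf_maxGenEigenspace_eq_zero
    (hT : ∀ i, IsHeckeFamily N c (T i))
    (hc : ∀ i (q q' : PrimesNotDvd N), Commute (T i q) (T i q')) (a : ι → ℂ)
    (htr : ∀ n : ℕ, 0 < n → n.Coprime N → ∑ i, a i * LinearMap.trace ℂ (V i) (T i n) = 0)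
    (χ : PrimesNotDvd N → ℂ) :
    ∑ i, a i * (Module.finrank ℂ
      (⨅ q : PrimesNotDvd N, (T i q).maxGenEigenspace (χ q) : Submodule ℂ (V i)) : ℂ) = 0 := by
  classical
  -- the other systems occurring in some `V i`
  obtain ⟨X, hXne, hX⟩ : ∃ X : Finset (PrimesNotDvd N → ℂ), (∀ ψ ∈ X, ψ ≠ χ) ∧
      ∀ i φ, (⨅ q : PrimesNotDvd N, (T i q).maxGenEigenspace (φ q) : Submodule ℂ (V i)) ≠ ⊥ →
        φ ≠ χ → φ ∈ X := by
    refine ⟨(Finset.univ.biUnion fun i => (finite_iInf_maxGenEigenspace_ne_bot (hc i)).toFinset).erase χ,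
      fun ψ hψ => (Finset.mem_erase.mp hψ).1, fun i φ hφ hne => ?_⟩
    exact Finset.mem_erase.mpr ⟨hne, Finset.mem_biUnion.mpr
      ⟨i, Finset.mem_univ i, (finite_iInf_maxGenEigenspace_ne_bot (hc i)).mem_toFinset.mpr hφ⟩⟩
  -- separating primes
  have hsep : ∀ ψ : X, ∃ q : PrimesNotDvd N, (ψ : PrimesNotDvd N → ℂ) q ≠ χ q := fun ψ =>
    Function.ne_iff.mp (hXne ψ ψ.2)
  choose qsep hqsep using hsep
  let L : List (ℕ × ℂ) :=
    X.attach.toList.map fun ψ => ((qsep ψ : ℕ), (ψ : PrimesNotDvd N → ℂ) (qsep ψ))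
  have hLprime : ∀ qa ∈ L, qa.1.Prime ∧ ¬ qa.1 ∣ N := by
    intro qa hqa
    obtain ⟨ψ, -, rfl⟩ := List.mem_map.mp hqa
    exact (qsep ψ).2
  let s : (PrimesNotDvd N → ℂ) → ℂ :=
    fun φ => ∏ ψ ∈ X.attach, (φ (qsep ψ) - (ψ : PrimesNotDvd N → ℂ) (qsep ψ))
  have hscalar : ∀ φ : PrimesNotDvd N → ℂ,
      (L.map fun qa => charExt φ qa.1 - qa.2).prod = s φ := by
    intro φ
    change ((X.attach.toList.map _).map _).prod = ∏ ψ ∈ X.attach, _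
    rw [List.map_map, Finset.prod_map_toList]
    simp only [Function.comp_apply, charExt_apply]
  have hsX : ∀ φ ∈ X, s φ = 0 := fun φ hφ =>
    Finset.prod_eq_zero (Finset.mem_attach X ⟨φ, hφ⟩) (sub_self _)
  have hsχ : s χ ≠ 0 := Finset.prod_ne_zero_iff.mpr fun ψ _ =>
    sub_ne_zero.mpr (hqsep ψ).symm
  -- the virtual trace of the killing product, block by block
  have h := sum_mul_trace_listProd_eq_zero hT a htr hLprime
  have hi : ∀ i, LinearMap.trace ℂ (V i) (IsHeckeFamily.listProd (T i) L) =
      (Module.finrank ℂ (⨅ q : PrimesNotDvd N, (T i q).maxGenEigenspace (χ q) :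
        Submodule ℂ (V i)) : ℂ) * s χ := by
    intro i
    rw [trace_listProd_eq_sum_finrank_iInf_maxGenEigenspace_mul (hc i) hLprime,
      Finset.sum_eq_single χ]
    · rw [hscalar]
    · intro φ hφ hne
      rw [hscalar, hsX φ (hX i φ ((finite_iInf_maxGenEigenspace_ne_bot (hc i)).mem_toFinset.mp hφ)
        hne), mul_zero]
    · intro hχ
      have : (⨅ q : PrimesNotDvd N, (T i q).maxGenEigenspace (χ q) : Submodule ℂ (V i)) = ⊥ := by
        by_contra hne
        exact hχ ((finite_iInf_maxGenEigenspace_ne_bot (hc i)).mem_toFinset.mpr hne)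
      rw [this, finrank_bot, Nat.cast_zero, zero_mul]
  simp only [hi, ← mul_assoc, ← Finset.sum_mul] at h
  exact (mul_eq_zero.mp h).resolve_right hsχ

/-- Integer-coefficient form of `sum_mul_finrank_iInf_maxGenEigenspace_eq_zero`.
[cite: Eichler1973, Ch. IV §1] -/
theorem sum_intCast_mul_finrank_iInf_maxGenEigenspace_eq_zero
    (hT : ∀ i, IsHeckeFamily N c (T i))
    (hc : ∀ i (q q' : PrimesNotDvd N), Commute (T i q) (T i q')) (a : ι → ℤ)
    (htr : ∀ n : ℕ, 0 < n → n.Coprime N → ∑ i, (a i : ℂ) * LinearMap.trace ℂ (V i) (T i n) = 0)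
    (χ : PrimesNotDvd N → ℂ) :
    ∑ i, a i * (Module.finrank ℂ
      (⨅ q : PrimesNotDvd N, (T i q).maxGenEigenspace (χ q) : Submodule ℂ (V i)) : ℤ) = 0 := by
  have h := sum_mul_finrank_iInf_maxGenEigenspace_eq_zero hT hc (fun i => (a i : ℂ)) htr χ
  exact_mod_cast h

end GenMultiplicity

/-! ### One space against a virtual sum of spaces -/

section TwoBlock

variable [Fintype ι] [∀ i, FiniteDimensional ℂ (V i)] {T : ∀ i, ℕ → Module.End ℂ (V i)}
  {W : Type v} [AddCommGroup W] [Module ℂ W] [FiniteDimensional ℂ W] {TW : ℕ → Module.End ℂ W}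

/-- **A trace identity `tr T_W(n) = Σ_i a_i tr T_i(n)` determines the generalised multiplicities of
`W`**: for commuting Hecke families (same `N`, same constants `c`) on finite-dimensional spaces
`W` and `V_i` and integers `a_i`, if `tr T_W(n) = Σ_i a_i tr T_i(n)` for all `n ≥ 1` prime to `N`,
then `dim W^χ = Σ_i a_i dim (V_i)^χ` for every eigenvalue system `χ` (simultaneous generalised
eigenspaces) — `sum_intCast_mul_finrank_iInf_maxGenEigenspace_eq_zero` for the virtual family
`-W + Σ_i a_i V_i` on `Option ι`. This is the form in which Eichler compares the Brandt matrices
`B_l(n)` with the `T(n)` on the `S_{l+2}(Γ₀(d))`. [cite: Eichler1973, Ch. IV §1] -/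
theorem finrank_iInf_maxGenEigenspace_eq_sum_of_trace_eq_sum
    (hW : IsHeckeFamily N c TW) (hT : ∀ i, IsHeckeFamily N c (T i))
    (hcW : ∀ q q' : PrimesNotDvd N, Commute (TW q) (TW q'))
    (hc : ∀ i (q q' : PrimesNotDvd N), Commute (T i q) (T i q')) (a : ι → ℤ)
    (htr : ∀ n : ℕ, 0 < n → n.Coprime N →
      LinearMap.trace ℂ W (TW n) = ∑ i, (a i : ℂ) * LinearMap.trace ℂ (V i) (T i n))
    (χ : PrimesNotDvd N → ℂ) :
    (Module.finrank ℂ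
        (⨅ q : PrimesNotDvd N, (TW q).maxGenEigenspace (χ q) : Submodule ℂ W) : ℤ) =
      ∑ i, a i * (Module.finrank ℂ
        (⨅ q : PrimesNotDvd N, (T i q).maxGenEigenspace (χ q) : Submodule ℂ (V i)) : ℤ) := by
  -- the virtual family on `Option ι`: `none ↦ (W, -1)`, `some i ↦ (V i, a i)`
  let V' : Option ι → Type v := fun o => o.elim W V
  letI instA : ∀ o, AddCommGroup (V' o) := fun o =>
    match o with
    | none => (inferInstance : AddCommGroup W)
    | some i => (inferInstance : AddCommGroup (V i))
  letI instM : ∀ o, Module ℂ (V' o) := fun o =>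
    match o with
    | none => (inferInstance : Module ℂ W)
    | some i => (inferInstance : Module ℂ (V i))
  haveI instF : ∀ o, FiniteDimensional ℂ (V' o) := fun o =>
    match o with
    | none => (inferInstance : FiniteDimensional ℂ W)
    | some i => (inferInstance : FiniteDimensional ℂ (V i))
  let T' : ∀ o, ℕ → Module.End ℂ (V' o) := fun o =>
    match o with
    | none => TW
    | some i => T i
  let a' : Option ι → ℤ := fun o => o.elim (-1) a
  have hT' : ∀ o, IsHeckeFamily N c (T' o) := fun o =>
    match o with
    | none => hW
    | some i => hT i
  have hc' : ∀ o (q q' : PrimesNotDvd N), Commute (T' o q) (T' o q') := fun o =>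
    match o with
    | none => hcW
    | some i => hc i
  have htr' : ∀ n : ℕ, 0 < n → n.Coprime N →
      ∑ o, (a' o : ℂ) * LinearMap.trace ℂ (V' o) (T' o n) = 0 := by
    intro n hn hnN
    rw [Fintype.sum_option]
    change ((-1 : ℤ) : ℂ) * LinearMap.trace ℂ W (TW n) +
      ∑ i, ((a i : ℤ) : ℂ) * LinearMap.trace ℂ (V i) (T i n) = 0
    rw [htr n hn hnN]
    push_cast
    ring
  have key := sum_intCast_mul_finrank_iInf_maxGenEigenspace_eq_zero hT' hc' a' htr' χ
  rw [Fintype.sum_option] at key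
  change (-1 : ℤ) * (Module.finrank ℂ
      (⨅ q : PrimesNotDvd N, (TW q).maxGenEigenspace (χ q) : Submodule ℂ W) : ℤ) +
    ∑ i, a i * (Module.finrank ℂ
      (⨅ q : PrimesNotDvd N, (T i q).maxGenEigenspace (χ q) : Submodule ℂ (V i)) : ℤ) = 0 at key
  linarith

end TwoBlock

end Literature.NumberTheory.Automorphic

end
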